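import Summits.QuantumFields.YangMills.Theorems.BalabanUVNodesN15KingModelProperTimeLine
import Summits.QuantumFields.YangMills.Theorems.BalabanUVNodesN15KingModelTwoPointOptimalDecay
import Mathlib.MeasureTheory.Integral.Pi
import Mathlib.Analysis.SpecialFunctions.ImproperIntegrals

/-!
# BalabanUVNodes ∕ N15 — THE KING-MODEL RUNG (PART Ϻ-b): THE SCHWINGER PROPER-TIME REPRESENTATION OF KING's CONTINUUM BLOCK TWO-POINT FUNCTION —
# `S₂^{ℝ}(z) = (2π)^{−(d+1)}∫₀^∞ e^{−tm²} Π_μ I_t(z_μ) dt = ∫₀^∞ e^{−tm²} Π_μ (Λ ∗ g_t)(z_μ) dt`, AND `S₂^{ℝ}(z) > 0` FOR EVERY `z ∈ ℤ^{d+1}`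
# (Track A, DAG node N15 = NE2; FAN-OUT v1.1 §N15 s3 «KING-MODEL RUNG»; uses parts Ϝ-j (`kingS2Inf`), Ϸ-c (integrability), Ϻ-a (the one-line engine); count-neutral)

HONEST FRAMING.  Count-neutral (cell `pub-ymgap`, seat `pub-ymgap-dag-n15-e` g35; `--supports stmt-QuantumFields-27366 --as helper` = K3⁸).  King's `A = 0`, `g = 0` model
([King1986] C. King, Commun. Math. Phys. **102** (1986) 649–677): the thermodynamic limit of the block-smeared Schwinger two-point function of Theorem 2.1's
continuum limit is the momentum integral `S₂^{ℝ}(z) = (2π)^{−(d+1)}∫_{ℝ^{d+1}}Π_μ sinc²(p_μ∕2)·cos(p·z)∕(|p|²+m²)dp` (part Ϝ-j, (4.5) at `η = 0`).  THIS FILE proves its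
SCHWINGER PROPER-TIME FORM: writing `1∕(|p|²+m²) = ∫₀^∞e^{−t(|p|²+m²)}dt` (Mathlib `integral_exp_mul_Ioi`) and exchanging the integrals (Fubini; majorant
`Π_μ(17+16π²)(1+p_μ²)⁻¹·e^{−tm²}` on `ℝ^{d+1} × (0,∞)`), the momentum integral at fixed proper time FACTORISES over the coordinates (`cos(p·z) = Re Π_μ e^{ip_μz_μ}`,
Mathlib `integral_fintype_prod_volume_eq_prod`, the odd sine parts vanish): `S₂^{ℝ}(z) = (2π)^{−(d+1)}∫₀^∞e^{−tm²}Π_μ I_t(z_μ)dt` with part Ϻ-a's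
`I_t(x) = ∫sinc²(q∕2)e^{−tq²}cos(qx)dq = 2π(Λ ∗ g_t)(x)`, i.e. `S₂^{ℝ}(z) = ∫₀^∞ e^{−tm²}Π_μ(Λ ∗ g_t)(z_μ)dt` — the heat kernel `Π_μ g_t(w_μ) = (4πt)^{−(d+1)∕2}e^{−|w|²∕4t}`
smeared in each coordinate by the tent `Λ = χ_{[0,1]} ∗ χ_{[−1,0]}` (the block form factor), weighted by `e^{−tm²}`: the POSITION-SPACE content of (2.22)'s covariance
(the continuum free propagator `C_m = ∫₀^∞e^{−tm²}g_t^{⊗(d+1)}dt` averaged over the two unit blocks).  CONSEQUENCE: ★★★ `S₂^{ℝ}(z) > 0` for EVERY separation `z`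
(parts Ϸ-j∕Ϸ-t had strict positivity on the coordinate axes and EVENTUAL positivity along rays only).  NOT Bałaban's objects; NOT a node discharge (N15 is booked through
n15-a's knit, untouched here); nothing continuum-Yang–Mills ∕ `ℝ⁴` ∕ OS ∕ Clay — «m» is the free field's mass.  0 `sorry`, 0 def; standard axioms.

WHAT THIS FILE PROVES (kernel).  §1 `inv_eq_integral_exp_Ioi` (Schwinger), `twoPtIntegrand_eq_integral_Ioi` (the integrand in proper-time form), `ae_snd_mem_Ioi`, ★ `integrable_properTime_uncurry`
(joint integrability on `ℝ^{d+1} × (0,∞)`), ★★ `integral_twoPtIntegrand_eq_integral_Ioi` (Fubini).  §2 `integral_sinc_sq_exp_mul_sin_eq_zero` (odd part), `integral_lineFactor` (the complex one-line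
integral `= I_t(x)`), `integrable_lineFactor`, ★★ **`integral_properTime_slice_eq_prod`** (FACTORISATION at fixed `t > 0`: `∫Π sinc²·e^{−t(|p|²+m²)}cos(p·z)dp = e^{−tm²}Π_μ I_t(z_μ)`).
§3 ★★★ **`kingS2Inf_eq_integral_properTime`**, ★★★ **`kingS2Inf_eq_integral_tent_gaussLine`** (the `(2π)^{d+1}` cancels), `integrableOn_properTime` (the proper-time density is integrable on `(0,∞)`).
§4 ★★★ **`kingS2Inf_pos`** (`0 < S₂^{ℝ}(z)`, every `z`), `kingS2Inf_ne_zero`, `abs_kingS2Inf_eq`.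

HONEST SCOPE.  King's free model, `m² > 0`, every `d`; the proper-time density is displayed, not integrated in closed form (Bessel functions are not introduced).  N15 untouched;
counts unmoved.  Locators (use): [King1986] Thm 2.1 (2.22) p.654, (4.5) p.670, (4.36) p.674, Thm 3.3 (3.6) p.655.
-/

noncomputable section

open scoped BigOperators Topology
open Filter MeasureTheory Set Function Complex

namespace Summit.QuantumFields.YangMills.BalabanUVNodes.N15KingModelRung.ProperTime

open Summit.QuantumFields.YangMills.BalabanUVNodes.N15KingModelRung.OptimalDecay
open Literature.Analysis.Fourier (tent tent_nonneg)

variable {d : ℕ}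

/-! ## §1 Schwinger's parametrisation and Fubini -/

/-- **Schwinger**: `a⁻¹ = ∫₀^∞ e^{−ta}dt` for `a > 0`. [folklore] -/
theorem inv_eq_integral_exp_Ioi {a : ℝ} (ha : 0 < a) : a⁻¹ = ∫ t in Ioi (0 : ℝ), Real.exp (-(t * a)) := by
  have h := integral_exp_mul_Ioi (a := -a) (by linarith) 0
  simp only [mul_zero, Real.exp_zero] at h
  have hpt : (fun t : ℝ => Real.exp (-(t * a))) = fun t => Real.exp (-a * t) := by
    funext t; ring_nf
  rw [hpt, h]
  field_simp

/-- The integrand of `S₂^{ℝ}` in proper-time form: `h_z(p) = ∫₀^∞ Π_μ sinc²(p_μ∕2)·e^{−t(|p|²+m²)}·cos(p·z)dt` (`m² > 0`). [cite: King1986, (4.5) p.670] -/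
theorem twoPtIntegrand_eq_integral_Ioi {m2 : ℝ} (hm : 0 < m2) (z : Fin (d + 1) → ℤ) (p : Fin (d + 1) → ℝ) :
    twoPtIntegrand m2 z p
      = ∫ t in Ioi (0 : ℝ), (∏ μ, Real.sinc (p μ / 2) ^ 2) * Real.exp (-(t * ((∑ μ, p μ ^ 2) + m2))) * Real.cos (∑ μ, p μ * z μ) := by
  rw [twoPtIntegrand_eq_prod]
  have hS : 0 < (∑ μ, p μ ^ 2) + m2 := add_pos_of_nonneg_of_pos (Finset.sum_nonneg fun μ _ => sq_nonneg _) hm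
  rw [div_eq_mul_inv, inv_eq_integral_exp_Ioi hS, ← integral_const_mul, ← integral_mul_const]

/-- A.e. on `ℝ^{d+1} × (0,∞)` (product of Lebesgue with Lebesgue restricted to `(0,∞)`) the proper time is positive. [folklore] -/
theorem ae_snd_mem_Ioi : ∀ᵐ x : (Fin (d + 1) → ℝ) × ℝ ∂((volume : Measure (Fin (d + 1) → ℝ)).prod (volume.restrict (Ioi (0 : ℝ)))), x.2 ∈ Ioi (0 : ℝ) :=
  (Measure.quasiMeasurePreserving_snd (μ := (volume : Measure (Fin (d + 1) → ℝ))) (ν := volume.restrict (Ioi (0 : ℝ)))).ae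
    (ae_restrict_mem measurableSet_Ioi)

/-- ★ Joint integrability of the proper-time integrand on `ℝ^{d+1} × (0,∞)` (majorant `Π_μ(17+16π²)(1+p_μ²)⁻¹ · e^{−tm²}`). [folklore] -/
theorem integrable_properTime_uncurry {m2 : ℝ} (hm : 0 < m2) (z : Fin (d + 1) → ℤ) :
    Integrable (uncurry fun (p : Fin (d + 1) → ℝ) (t : ℝ) =>
        (∏ μ, Real.sinc (p μ / 2) ^ 2) * Real.exp (-(t * ((∑ μ, p μ ^ 2) + m2))) * Real.cos (∑ μ, p μ * z μ))
      ((volume : Measure (Fin (d + 1) → ℝ)).prod (volume.restrict (Ioi (0 : ℝ)))) := by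
  have hW : Integrable (fun p : Fin (d + 1) → ℝ => ∏ μ, ((17 + 16 * Real.pi ^ 2) * (1 + p μ ^ 2)⁻¹)) :=
    Integrable.fintype_prod (f := fun (_ : Fin (d + 1)) (x : ℝ) => (17 + 16 * Real.pi ^ 2) * (1 + x ^ 2)⁻¹)
      fun _ => integrable_inv_one_add_sq.const_mul _
  have hE : Integrable (fun t : ℝ => Real.exp (-m2 * t)) (volume.restrict (Ioi (0 : ℝ))) := exp_neg_integrableOn_Ioi 0 hm
  have hmaj := hW.mul_prod hE
  have hcont : Continuous (uncurry fun (p : Fin (d + 1) → ℝ) (t : ℝ) =>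
      (∏ μ, Real.sinc (p μ / 2) ^ 2) * Real.exp (-(t * ((∑ μ, p μ ^ 2) + m2))) * Real.cos (∑ μ, p μ * z μ)) := by
    have : (uncurry fun (p : Fin (d + 1) → ℝ) (t : ℝ) =>
        (∏ μ, Real.sinc (p μ / 2) ^ 2) * Real.exp (-(t * ((∑ μ, p μ ^ 2) + m2))) * Real.cos (∑ μ, p μ * z μ))
        = fun x : (Fin (d + 1) → ℝ) × ℝ => (∏ μ, Real.sinc (x.1 μ / 2) ^ 2) * Real.exp (-(x.2 * ((∑ μ, x.1 μ ^ 2) + m2))) * Real.cos (∑ μ, x.1 μ * z μ) := by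
      funext x; rfl
    rw [this]
    fun_prop
  refine hmaj.mono' hcont.aestronglyMeasurable ?_
  filter_upwards [ae_snd_mem_Ioi] with x hx
  simp only [uncurry, Real.norm_eq_abs]
  rw [abs_mul, abs_mul, abs_of_nonneg (Finset.prod_nonneg fun μ _ => sq_nonneg _), Real.abs_exp]
  have ht : 0 < x.2 := hx
  have hS : 0 ≤ ∑ μ, x.1 μ ^ 2 := Finset.sum_nonneg fun μ _ => sq_nonneg _
  have h1 : ∏ μ, Real.sinc (x.1 μ / 2) ^ 2 ≤ ∏ μ, ((17 + 16 * Real.pi ^ 2) * (1 + x.1 μ ^ 2)⁻¹) :=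
    Finset.prod_le_prod (fun μ _ => sq_nonneg _) fun μ _ => sinc_sq_half_window (s := x.1 μ) (t := x.1 μ) (by simp; positivity)
  have h2 : Real.exp (-(x.2 * ((∑ μ, x.1 μ ^ 2) + m2))) ≤ Real.exp (-m2 * x.2) := Real.exp_le_exp.mpr (by nlinarith)
  have h3 : |Real.cos (∑ μ, x.1 μ * z μ)| ≤ 1 := Real.abs_cos_le_one _
  have hW0 : 0 ≤ ∏ μ, ((17 + 16 * Real.pi ^ 2) * (1 + x.1 μ ^ 2)⁻¹) := Finset.prod_nonneg fun μ _ => by positivity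
  calc (∏ μ, Real.sinc (x.1 μ / 2) ^ 2) * Real.exp (-(x.2 * ((∑ μ, x.1 μ ^ 2) + m2))) * |Real.cos (∑ μ, x.1 μ * z μ)|
      ≤ (∏ μ, ((17 + 16 * Real.pi ^ 2) * (1 + x.1 μ ^ 2)⁻¹)) * Real.exp (-m2 * x.2) * 1 := by
        gcongr
    _ = (∏ μ, ((17 + 16 * Real.pi ^ 2) * (1 + x.1 μ ^ 2)⁻¹)) * Real.exp (-m2 * x.2) := mul_one _

/-- ★★ **Fubini**: `∫_{ℝ^{d+1}} h_z = ∫₀^∞ [∫_{ℝ^{d+1}} Π sinc²·e^{−t(|p|²+m²)}·cos(p·z)dp] dt`. [cite: King1986, (4.5) p.670] -/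
theorem integral_twoPtIntegrand_eq_integral_Ioi {m2 : ℝ} (hm : 0 < m2) (z : Fin (d + 1) → ℤ) :
    ∫ p : Fin (d + 1) → ℝ, twoPtIntegrand m2 z p
      = ∫ t in Ioi (0 : ℝ), ∫ p : Fin (d + 1) → ℝ,
          (∏ μ, Real.sinc (p μ / 2) ^ 2) * Real.exp (-(t * ((∑ μ, p μ ^ 2) + m2))) * Real.cos (∑ μ, p μ * z μ) := by
  have h := integral_integral_swap (integrable_properTime_uncurry hm z)
  rw [← h]
  exact integral_congr_ae (Eventually.of_forall fun p => twoPtIntegrand_eq_integral_Ioi hm z p)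

/-! ## §2 Factorisation of the momentum integral at fixed proper time -/

/-- The odd part vanishes: `∫ sinc²(q∕2)e^{−tq²}sin(qx)dq = 0`. [folklore] -/
theorem integral_sinc_sq_exp_mul_sin_eq_zero (t x : ℝ) : ∫ q : ℝ, Real.sinc (q / 2) ^ 2 * Real.exp (-(t * q ^ 2)) * Real.sin (q * x) = 0 := by
  have h := integral_neg_eq_self (fun q : ℝ => Real.sinc (q / 2) ^ 2 * Real.exp (-(t * q ^ 2)) * Real.sin (q * x)) volume
  have hodd : (fun q : ℝ => Real.sinc (-q / 2) ^ 2 * Real.exp (-(t * (-q) ^ 2)) * Real.sin (-q * x))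
      = fun q => -(Real.sinc (q / 2) ^ 2 * Real.exp (-(t * q ^ 2)) * Real.sin (q * x)) := by
    funext q
    rw [neg_div, Real.sinc_neg, neg_sq, neg_mul, Real.sin_neg]
    ring
  rw [hodd, integral_neg] at h
  linarith

/-- The one-line integrand `sinc²(q∕2)e^{−tq²}` times a bounded factor is integrable (`t ≥ 0`). [folklore] -/
theorem integrable_sinc_sq_exp_mul {t : ℝ} (ht : 0 ≤ t) {φ : ℝ → ℝ} (hφ : Continuous φ) (hb : ∀ q, |φ q| ≤ 1) :
    Integrable fun q : ℝ => Real.sinc (q / 2) ^ 2 * Real.exp (-(t * q ^ 2)) * φ q := by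
  have hA : Integrable fun q : ℝ => Real.sinc (q / 2) ^ 2 := by
    have h := integrable_sinc_sq_half_mul_cos 0
    simp only [mul_zero, Real.cos_zero, mul_one] at h
    exact h
  refine hA.mono' (by fun_prop : Continuous fun q : ℝ => Real.sinc (q / 2) ^ 2 * Real.exp (-(t * q ^ 2)) * φ q).aestronglyMeasurable
    (Eventually.of_forall fun q => ?_)
  rw [Real.norm_eq_abs, abs_mul, abs_mul, abs_of_nonneg (sq_nonneg _), Real.abs_exp]
  have he : Real.exp (-(t * q ^ 2)) ≤ 1 := by
    rw [Real.exp_le_one_iff]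
    nlinarith [sq_nonneg q]
  have hφq := hb q
  calc Real.sinc (q / 2) ^ 2 * Real.exp (-(t * q ^ 2)) * |φ q| ≤ Real.sinc (q / 2) ^ 2 * 1 * 1 := by
        gcongr
    _ = Real.sinc (q / 2) ^ 2 := by ring

/-- The complex one-line factor `f_x(q) = sinc²(q∕2)e^{−tq²}·e^{iqx}` is integrable (`t ≥ 0`). [folklore] -/
theorem integrable_lineFactor {t : ℝ} (ht : 0 ≤ t) (x : ℝ) :
    Integrable fun q : ℝ => ((Real.sinc (q / 2) ^ 2 * Real.exp (-(t * q ^ 2)) : ℝ) : ℂ) * Complex.exp (((q * x : ℝ) : ℂ) * I) := by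
  have hA : Integrable fun q : ℝ => Real.sinc (q / 2) ^ 2 * Real.exp (-(t * q ^ 2)) * (1 : ℝ) :=
    integrable_sinc_sq_exp_mul ht continuous_const fun q => by simp
  have hA' : Integrable fun q : ℝ => ‖((Real.sinc (q / 2) ^ 2 * Real.exp (-(t * q ^ 2)) : ℝ) : ℂ)‖ := by
    refine (hA.norm).congr (Eventually.of_forall fun q => ?_)
    simp only [mul_one, Complex.norm_real]
  refine hA'.mono' (by fun_prop : Continuous fun q : ℝ =>
      ((Real.sinc (q / 2) ^ 2 * Real.exp (-(t * q ^ 2)) : ℝ) : ℂ) * Complex.exp (((q * x : ℝ) : ℂ) * I)).aestronglyMeasurable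
    (Eventually.of_forall fun q => ?_)
  rw [norm_mul, Complex.norm_exp_ofReal_mul_I, mul_one]

/-- The complex one-line integral IS `I_t(x)`: `∫ sinc²(q∕2)e^{−tq²}e^{iqx}dq = I_t(x)` (its imaginary part, the sine integral, vanishes). [folklore] -/
theorem integral_lineFactor {t : ℝ} (ht : 0 ≤ t) (x : ℝ) :
    ∫ q : ℝ, ((Real.sinc (q / 2) ^ 2 * Real.exp (-(t * q ^ 2)) : ℝ) : ℂ) * Complex.exp (((q * x : ℝ) : ℂ) * I) = ((lineHeat t x : ℝ) : ℂ) := by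
  have hint := integrable_lineFactor ht x
  apply Complex.ext
  · have h := integral_re hint
    simp only [RCLike.re_to_complex] at h
    rw [← h, Complex.ofReal_re, lineHeat]
    refine integral_congr_ae (Eventually.of_forall fun q => ?_)
    simp only
    rw [Complex.re_ofReal_mul, Complex.exp_ofReal_mul_I_re]
  · have h := integral_im hint
    simp only [RCLike.im_to_complex] at h
    rw [← h, Complex.ofReal_im]
    have hpt : (fun q : ℝ => (((Real.sinc (q / 2) ^ 2 * Real.exp (-(t * q ^ 2)) : ℝ) : ℂ) * Complex.exp (((q * x : ℝ) : ℂ) * I)).im)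
        = fun q => Real.sinc (q / 2) ^ 2 * Real.exp (-(t * q ^ 2)) * Real.sin (q * x) := by
      funext q
      rw [Complex.im_ofReal_mul, Complex.exp_ofReal_mul_I_im]
    rw [hpt, integral_sinc_sq_exp_mul_sin_eq_zero]

/-- ★★ **FACTORISATION AT FIXED PROPER TIME**: for `t > 0`,
`∫_{ℝ^{d+1}} Π_μ sinc²(p_μ∕2)·e^{−t(|p|²+m²)}·cos(p·z)dp = e^{−tm²}·Π_μ I_t(z_μ)` (`cos(p·z) = Re Π_μ e^{ip_μ z_μ}`, Fubini over the coordinates, odd parts vanish).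
[cite: King1986, (4.5) p.670, (4.36) p.674] -/
theorem integral_properTime_slice_eq_prod {m2 t : ℝ} (ht : 0 < t) (z : Fin (d + 1) → ℤ) :
    ∫ p : Fin (d + 1) → ℝ, (∏ μ, Real.sinc (p μ / 2) ^ 2) * Real.exp (-(t * ((∑ μ, p μ ^ 2) + m2))) * Real.cos (∑ μ, p μ * z μ)
      = Real.exp (-(t * m2)) * ∏ μ, lineHeat t (z μ) := by
  -- the complex factors
  set g : Fin (d + 1) → ℝ → ℂ := fun μ q => ((Real.sinc (q / 2) ^ 2 * Real.exp (-(t * q ^ 2)) : ℝ) : ℂ) * Complex.exp (((q * (z μ : ℝ) : ℝ) : ℂ) * I) with hg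
  have hG : Integrable (fun p : Fin (d + 1) → ℝ => ∏ μ, g μ (p μ)) := Integrable.fintype_prod (f := g) fun μ => integrable_lineFactor ht.le _
  -- pointwise: the real integrand is `e^{−tm²}·Re Π_μ g_μ(p_μ)`
  have hpt : ∀ p : Fin (d + 1) → ℝ, (∏ μ, Real.sinc (p μ / 2) ^ 2) * Real.exp (-(t * ((∑ μ, p μ ^ 2) + m2))) * Real.cos (∑ μ, p μ * z μ)
      = Real.exp (-(t * m2)) * (∏ μ, g μ (p μ)).re := by
    intro p
    have hprod : ∏ μ, g μ (p μ) = (((∏ μ, Real.sinc (p μ / 2) ^ 2 * Real.exp (-(t * p μ ^ 2))) : ℝ) : ℂ) * Complex.exp (((∑ μ, p μ * (z μ : ℝ) : ℝ) : ℂ) * I) := by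
      simp only [hg]
      rw [Finset.prod_mul_distrib, ← Complex.ofReal_prod, ← Complex.exp_sum, ← Finset.sum_mul, ← Complex.ofReal_sum]
    rw [hprod, Complex.re_ofReal_mul, Complex.exp_ofReal_mul_I_re, Finset.prod_mul_distrib]
    have hexp : ∏ μ, Real.exp (-(t * p μ ^ 2)) = Real.exp (-(t * ∑ μ, p μ ^ 2)) := by
      rw [← Real.exp_sum, Finset.mul_sum, ← Finset.sum_neg_distrib]
    rw [hexp]
    have hsum : (∑ μ, p μ * (z μ : ℝ)) = ∑ μ, p μ * z μ := rfl
    rw [hsum, show -(t * ((∑ μ, p μ ^ 2) + m2)) = -(t * m2) + -(t * ∑ μ, p μ ^ 2) by ring, Real.exp_add]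
    ring
  simp_rw [hpt]
  rw [integral_const_mul]
  congr 1
  have hre := integral_re hG
  simp only [RCLike.re_to_complex] at hre
  rw [hre, integral_fintype_prod_volume_eq_prod]
  have hfac : ∀ μ : Fin (d + 1), ∫ q : ℝ, g μ q = ((lineHeat t (z μ) : ℝ) : ℂ) := fun μ => integral_lineFactor ht.le _
  simp_rw [hfac]
  rw [← Complex.ofReal_prod, Complex.ofReal_re]

/-! ## §3 The proper-time representation -/

/-- ★★★ **THE SCHWINGER PROPER-TIME REPRESENTATION OF KING's CONTINUUM BLOCK TWO-POINT FUNCTION**: for `m² > 0`, every `d` and every `z ∈ ℤ^{d+1}`,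
`S₂^{ℝ}(z) = (2π)^{−(d+1)}·∫₀^∞ e^{−tm²}·Π_μ I_t(z_μ) dt`, `I_t(x) = ∫_ℝ sinc²(q∕2)e^{−tq²}cos(qx)dq`. [cite: King1986, Thm 2.1 (2.22) p.654, (4.5) p.670, (4.36) p.674] -/
theorem kingS2Inf_eq_integral_properTime {m2 : ℝ} (hm : 0 < m2) (z : Fin (d + 1) → ℤ) :
    kingS2Inf m2 z = ((2 * Real.pi) ^ (d + 1))⁻¹ * ∫ t in Ioi (0 : ℝ), Real.exp (-(t * m2)) * ∏ μ, lineHeat t (z μ) := by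
  unfold kingS2Inf
  rw [integral_twoPtIntegrand_eq_integral_Ioi hm z]
  congr 1
  refine setIntegral_congr_fun measurableSet_Ioi fun t ht => ?_
  exact integral_properTime_slice_eq_prod ht z

/-- ★★★ **THE HEAT-KERNEL FORM**: `S₂^{ℝ}(z) = ∫₀^∞ e^{−tm²}·Π_μ [∫_ℝ Λ(u)·g_t(z_μ − u)du] dt` — the `(d+1)`-dimensional heat kernel `Π_μ g_t = (4πt)^{−(d+1)∕2}e^{−|·|²∕4t}`
smeared in each coordinate by the tent `Λ = (1−|u|)₊ = χ_{[0,1]} ∗ χ_{[−1,0]}` (the two unit blocks), weighted by `e^{−tm²}` (the `(2π)^{d+1}` of part Ϻ-a cancels the prefactor).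
[cite: King1986, Thm 2.1 (2.22) p.654, (4.5) p.670, Thm 3.3 (3.6) p.655] -/
theorem kingS2Inf_eq_integral_tent_gaussLine {m2 : ℝ} (hm : 0 < m2) (z : Fin (d + 1) → ℤ) :
    kingS2Inf m2 z = ∫ t in Ioi (0 : ℝ), Real.exp (-(t * m2)) * ∏ μ, ∫ u : ℝ, tent 1 u * gaussLine t ((z μ : ℝ) - u) := by
  rw [kingS2Inf_eq_integral_properTime hm z, ← integral_const_mul]
  refine setIntegral_congr_fun measurableSet_Ioi fun t ht => ?_
  have hμ : ∀ μ : Fin (d + 1), lineHeat t (z μ) = 2 * Real.pi * ∫ u : ℝ, tent 1 u * gaussLine t ((z μ : ℝ) - u) := fun μ => lineHeat_eq_integral_tent ht _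
  simp_rw [hμ]
  rw [Finset.prod_mul_distrib, Finset.prod_const, Finset.card_univ, Fintype.card_fin]
  have hπ : (2 * Real.pi) ^ (d + 1) ≠ 0 := by positivity
  field_simp

/-- The proper-time density `t ↦ e^{−tm²}Π_μ I_t(z_μ)` is integrable on `(0,∞)` (Fubini's other half, through the factorisation). [folklore] -/
theorem integrableOn_properTime {m2 : ℝ} (hm : 0 < m2) (z : Fin (d + 1) → ℤ) :
    IntegrableOn (fun t : ℝ => Real.exp (-(t * m2)) * ∏ μ, lineHeat t (z μ)) (Ioi (0 : ℝ)) := by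
  have h := (integrable_properTime_uncurry hm z).integral_prod_right
  refine h.congr ?_
  filter_upwards [ae_restrict_mem measurableSet_Ioi] with t ht
  exact integral_properTime_slice_eq_prod ht z

/-! ## §4 Positivity everywhere -/

/-- ★★★ **`S₂^{ℝ}(z) > 0` FOR EVERY `z ∈ ℤ^{d+1}`** (`m² > 0`, every `d`): the continuum block two-point function of King's free field is STRICTLY POSITIVE at every separation —
the proper-time density `e^{−tm²}Π_μ I_t(z_μ)` is positive on `(0,∞)` by part Ϻ-a's `I_t > 0`. [cite: King1986, Thm 2.1 (2.22) p.654, (4.5) p.670; folklore (Griffiths' first inequality, free field)] -/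
theorem kingS2Inf_pos {m2 : ℝ} (hm : 0 < m2) (z : Fin (d + 1) → ℤ) : 0 < kingS2Inf m2 z := by
  rw [kingS2Inf_eq_integral_properTime hm z]
  refine mul_pos (by positivity) ?_
  set f : ℝ → ℝ := fun t => Real.exp (-(t * m2)) * ∏ μ, lineHeat t (z μ) with hf
  have hpos : ∀ t : ℝ, 0 < t → 0 < f t := fun t ht => by
    simp only [hf]
    exact mul_pos (Real.exp_pos _) (Finset.prod_pos fun μ _ => lineHeat_pos ht _)
  have hnn : 0 ≤ᵐ[volume.restrict (Ioi (0 : ℝ))] f := by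
    filter_upwards [ae_restrict_mem measurableSet_Ioi] with t ht
    exact (hpos t ht).le
  rw [setIntegral_pos_iff_support_of_nonneg_ae hnn (integrableOn_properTime hm z)]
  have hsub : Ioi (0 : ℝ) ⊆ support f ∩ Ioi 0 := fun t ht => ⟨(hpos t ht).ne', ht⟩
  refine lt_of_lt_of_le ?_ (measure_mono hsub)
  rw [Real.volume_Ioi]
  exact ENNReal.zero_lt_top

/-- `S₂^{ℝ}(z) ≠ 0`. [folklore] -/
theorem kingS2Inf_ne_zero {m2 : ℝ} (hm : 0 < m2) (z : Fin (d + 1) → ℤ) : kingS2Inf m2 z ≠ 0 := (kingS2Inf_pos hm z).ne'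

/-- `|S₂^{ℝ}(z)| = S₂^{ℝ}(z)` (so every absolute-value bound of parts Ϸ-c∕r∕s is a bound on `S₂^{ℝ}` itself, and conversely). [folklore] -/
theorem abs_kingS2Inf_eq {m2 : ℝ} (hm : 0 < m2) (z : Fin (d + 1) → ℤ) : |kingS2Inf m2 z| = kingS2Inf m2 z := abs_of_pos (kingS2Inf_pos hm z)

/-- ★ `0 < S₂^{ℝ}(z) ≤ m⁻²` (with part Ϝ-j's volume-free bound). [cite: King1986, Thm 2.1 (2.23) p.654] -/
theorem kingS2Inf_pos_le {m2 : ℝ} (hm : 0 < m2) (z : Fin (d + 1) → ℤ) : 0 < kingS2Inf m2 z ∧ kingS2Inf m2 z ≤ m2⁻¹ :=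
  ⟨kingS2Inf_pos hm z, (le_abs_self _).trans (abs_kingS2Inf_le hm z)⟩

end Summit.QuantumFields.YangMills.BalabanUVNodes.N15KingModelRung.ProperTime
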